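import Literature.NumberTheory.EllipticCurves.SharpFlatPAdicLFunctionCoeffField
import Literature.NumberTheory.EllipticCurves.IwasawaAlgebraGeneratorChange
import Literature.NumberTheory.EllipticCurves.PAdicMeasureTransformWeightTwist
import Mathlib.NumberTheory.DirichletCharacter.Basic
import HarnessLib

/-!
# S4‴ THE MATCH, bookkeeping I: the `𝔞`-factor `N𝔞 − ψ(𝔞)·χ⁻¹(N𝔞)` as a UNIT of `Λ_𝒪` with polynomial representatives, and the
# dictionary `χ(u) = χ(γ)^{ℓ(u)}` for the characters of `Γ`

Summit `BirchSwinnertonDyer`, crux `SmallImageLowerHalfBothSigns` (stmt-23599), line `rtt_w3`, stub S4‴ `stub_junctionRecipValues_ns` («THE MATCH ⇒ hval»,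
LEAD g15 RULING 14:42Z item (ii)). Namespace `…Theorems.SmallImageRttReciprocity`. THEOREMS ONLY.

The value law (Kato (15.9.1)) carries the `χ`-dependent factor `N𝔞 − ψ(𝔞)·χ⁻¹(𝔞)`; in S4‴'s `hval` (LEAD `isCongrModOmegaO_of_primitive_values`)
such factors must be absorbed into the slots `(U : (IwasawaAlgebraO S)ˣ, u : ℕ → 𝒪_S[X], hu : U − u n ∈ span{(1+X)^{pⁿ} − 1})` and read at `ζ − 1`.

* §1 `exists_unit_sub_mul_onePlusXPow` — for `N, b ∈ 𝒪_S` with `N − b ∈ 𝒪_Sˣ` and a `p`-adic exponent `a`: a unit `U ∈ Λ_𝒪ˣ` (namely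
  `N − b·(1+T)^a`) with `U ≡ u_n := N − b·(1+X)^{m_n} (mod (1+X)^{pⁿ} − 1)`, `m_n = (a mod pⁿ) ∈ [0, pⁿ)` (`(1+T)^a ≡ (1+T)^{m_n}`, tree
  `IwasawaAlgebra.exists_binomialSeries_sub_pow_eq`); `eval_sub_mul_onePlusXPow` — `u_n(ζ − 1) = N − b·ζ^{m_n}`.
* §2 `apply_eq_apply_cyclotomicGenerator_pow_gammaLog` — for a character `χ` of `(ℤ/p^{n+e₀})ˣ` which is even and of `p`-power order (a character
  of `Γ_n`), `χ(u) = χ(γ)^{ℓ_n(u)}` on units, `ℓ_n = gammaLog p n` the tree's discrete logarithm to the base `γ` (`u = ω(u)·γ^{ℓ(u)}`, `χ` kills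
  the Teichmüller part); values in ANY commutative ring (used with `ℂ` on the θ-side and `ℚ̄_p` on the Coleman side).

References: [Washington1997] §7.2, §13.2; [MazurTateTeitelbaum1986Invent] §I.13; [Kato2004Asterisque] (15.9.1).
-/

-- the Theorems namespace of this sub repeats the summit name by design (D-0017 nested layout)
set_option linter.dupNamespace false

noncomputable section

open scoped Classical
open Polynomial Literature.NumberTheory.EllipticCurves

namespace Summit.BirchSwinnertonDyer.BirchSwinnertonDyer.Theorems.SmallImageRttReciprocity

variable {p : ℕ} [Fact p.Prime]

/-! ### §1 The `𝔞`-factor as a unit of `Λ_𝒪` -/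

section Unit

variable (S : Set (PadicAlgCl p))

/-- ★ **`N − b·(1+T)^a` is a unit of `Λ_𝒪 = 𝒪_S⟦T⟧` congruent to the POLYNOMIAL `N − b·(1+X)^{m_n}`, `m_n = a mod pⁿ`, modulo `(1+X)^{pⁿ} − 1`,
for every `n`** — provided `N − b ∈ 𝒪_Sˣ` (the constant term). The slots `(U, u_n, hu)` of `isCongrModOmegaO_of_primitive_values` for the `𝔞`-factor
of Kato's value law. [cite: Washington1997, §13.2] [cite: MazurTateTeitelbaum1986Invent, §I.13] -/
theorem exists_unit_sub_mul_onePlusXPow (N b : padicCoeffIntegers S) (hNb : IsUnit (N - b)) (a : ℤ_[p]) :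
    ∃ U : (IwasawaAlgebraO S)ˣ, ∀ n : ℕ,
      (U : IwasawaAlgebraO S) - ((C N - C b * (1 + X) ^ (PadicInt.toZModPow n a).val : (padicCoeffIntegers S)[X]) : IwasawaAlgebraO S) ∈
        Ideal.span {(1 + PowerSeries.X : IwasawaAlgebraO S) ^ p ^ n - 1} := by
  -- `V = (1+T)^a` transported to `𝒪_S⟦T⟧`
  set V : IwasawaAlgebraO S := iwasawaToIwasawaO S (PowerSeries.binomialSeries ℤ_[p] a) with hV
  have hV1 : PowerSeries.constantCoeff V = 1 := by
    rw [hV, iwasawaToIwasawaO, ← PowerSeries.coeff_zero_eq_constantCoeff_apply, PowerSeries.coeff_map,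
      PowerSeries.coeff_zero_eq_constantCoeff_apply, PowerSeries.binomialSeries_constantCoeff, map_one]
  have hU0 : IsUnit (PowerSeries.C N - PowerSeries.C b * V : IwasawaAlgebraO S) := by
    rw [PowerSeries.isUnit_iff_constantCoeff, map_sub, map_mul, PowerSeries.constantCoeff_C, PowerSeries.constantCoeff_C, hV1, mul_one]
    exact hNb
  refine ⟨hU0.unit, fun n ↦ ?_⟩
  haveI : NeZero (p ^ n) := ⟨pow_ne_zero n (Fact.out : p.Prime).ne_zero⟩
  obtain ⟨q, hq⟩ := exists_binomialSeries_sub_pow_eq (p := p) (n := n) (x := a) (m := (PadicInt.toZModPow n a).val)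
    (ZMod.natCast_zmod_val _).symm
  have hq' : V - (1 + PowerSeries.X : IwasawaAlgebraO S) ^ (PadicInt.toZModPow n a).val =
      ((1 + PowerSeries.X : IwasawaAlgebraO S) ^ p ^ n - 1) * iwasawaToIwasawaO S q := by
    have h := congrArg (iwasawaToIwasawaO S) hq
    simpa [iwasawaToIwasawaO, hV] using h
  rw [IsUnit.unit_spec, Polynomial.coe_sub, Polynomial.coe_mul, Polynomial.coe_pow, Polynomial.coe_add, Polynomial.coe_one, Polynomial.coe_X,
    Polynomial.coe_C, Polynomial.coe_C]
  refine Ideal.mem_span_singleton'.mpr ⟨-(PowerSeries.C b * iwasawaToIwasawaO S q), ?_⟩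
  linear_combination (PowerSeries.C b) * hq'

/-- **Reading the representative at `ζ − 1`: `u_n(ζ − 1) = N − b·ζ^{m}`.** [cite: MazurTateTeitelbaum1986Invent, §I.13] -/
theorem eval_sub_mul_onePlusXPow (N b : padicCoeffIntegers S) (m : ℕ) (ζ : PadicAlgCl p) :
    ((C N - C b * (1 + X) ^ m : (padicCoeffIntegers S)[X]).map (padicCoeffIntegers S).subtype).eval (ζ - 1) =
      (N : PadicAlgCl p) - (b : PadicAlgCl p) * ζ ^ m := by
  simp [Polynomial.map_sub, Polynomial.map_mul, Polynomial.map_pow]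

end Unit

/-! ### §2 The dictionary `χ(u) = χ(γ)^{ℓ(u)}` -/

section Dictionary

/-- **A character of `Γ_n` kills the Teichmüller part**: for `χ` mod `p^m`, even and of `p`-power order, `χ(ω) = 1` for every `(p−1)`-st
(resp. square, `p = 2`) root of unity `ω ∈ ℤ_p` (orders coprime, resp. evenness). Values in any commutative ring (the tree's
`apply_toZModPow_rootsOfUnity` is the case `ℂ_p`, same proof). [cite: Washington1997, §7.2] [cite: MazurTateTeitelbaum1986Invent, §I.13] -/
theorem apply_toZModPow_rootsOfUnity_eq_one' {F : Type*} [CommRing F] {m : ℕ} (χ : DirichletCharacter F (p ^ m)) (heven : χ.Even)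
    (hord : ∃ j : ℕ, orderOf χ = p ^ j) (η : rootsOfUnity (torsionOrder p) ℤ_[p]) :
    χ (PadicInt.toZModPow m ((η : ℤ_[p]ˣ) : ℤ_[p])) = 1 := by
  obtain ⟨j, hj⟩ := hord
  have hp : p.Prime := Fact.out
  have hητ := rootsOfUnity_pow_torsionOrder p η
  by_cases h2 : p = 2
  · have hτ : torsionOrder p = 2 := by rw [torsionOrder_eq, if_pos h2]
    have hsq : ((η : ℤ_[p]ˣ) : ℤ_[p]) * ((η : ℤ_[p]ˣ) : ℤ_[p]) = 1 := by
      rw [← sq, ← hτ]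
      exact hητ
    rcases mul_self_eq_one_iff.mp hsq with h | h
    · rw [h, map_one, map_one]
    · rw [h, map_neg, map_one]
      exact heven
  · have hτ : torsionOrder p = p - 1 := by rw [torsionOrder_eq, if_neg h2]
    obtain ⟨v, hv⟩ : IsUnit (PadicInt.toZModPow m ((η : ℤ_[p]ˣ) : ℤ_[p])) := (Units.isUnit _).map _
    have h1 : χ (v : ZMod (p ^ m)) ^ (p - 1) = 1 := by
      rw [← map_pow, hv, ← map_pow, ← hτ, hητ, map_one, map_one]
    have h2' : χ (v : ZMod (p ^ m)) ^ (p ^ j) = 1 := by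
      rw [← MulChar.pow_apply_coe, ← hj, pow_orderOf_eq_one, MulChar.one_apply_coe]
    have hcop : Nat.Coprime (p - 1) (p ^ j) :=
      Nat.Coprime.pow_right j ((Nat.coprime_self_sub_left hp.one_le).mpr (Nat.coprime_one_left p))
    have h := pow_gcd_eq_one.mpr ⟨h1, h2'⟩
    rw [hcop.gcd_eq_one, pow_one] at h
    rw [← hv, h]

/-- ★ **The dictionary `χ(u) = χ(γ)^{ℓ_n(u)}`**: for a character `χ` mod `p^{n+e₀}` which is even and of `p`-power order (a character of
`Γ_n = (ℤ/p^{n+e₀})ˣ/μ_τ`), and every unit `u = ω·γ^{ℓ_n(u)}` (`ℓ_n = gammaLog p n`, the tree's discrete logarithm to the base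
`γ = cyclotomicGenerator p`): `χ(u) = χ(γ)^{ℓ_n(u)}`. With `χ(γ) = ζ` (the θ-side dictionary `exists_dirichletCharacter_apply_cyclotomicGenerator_eq`)
this reads `χ(u) = ζ^{ℓ_n(u)}`. [cite: Washington1997, §7.2] [cite: MazurTateTeitelbaum1986Invent, §I.13] -/
theorem apply_eq_apply_cyclotomicGenerator_pow_gammaLog {F : Type*} [CommRing F] {n : ℕ} (χ : DirichletCharacter F (p ^ (n + cyclotomicExponent p)))
    (heven : χ.Even) (hord : ∃ j : ℕ, orderOf χ = p ^ j) {u : ZMod (p ^ (n + cyclotomicExponent p))} (hu : IsUnit u) :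
    χ u = χ (cyclotomicGenerator p : ZMod (p ^ (n + cyclotomicExponent p))) ^ (gammaLog p n u).val := by
  obtain ⟨η, s, rfl⟩ := exists_classMap_eq_of_isUnit p n hu
  rw [gammaLog_classMap, map_mul, map_pow, apply_toZModPow_rootsOfUnity_eq_one' χ heven hord η, one_mul]

/-- **Inverse form**: `χ⁻¹(u) · χ(γ)^{ℓ_n(u)} = 1` on units (`χ⁻¹(u)·χ(u) = 1`). [cite: Washington1997, §7.2] -/
theorem inv_apply_mul_apply_cyclotomicGenerator_pow_gammaLog {F : Type*} [CommRing F] {n : ℕ}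
    (χ : DirichletCharacter F (p ^ (n + cyclotomicExponent p))) (heven : χ.Even) (hord : ∃ j : ℕ, orderOf χ = p ^ j)
    {u : ZMod (p ^ (n + cyclotomicExponent p))} (hu : IsUnit u) :
    χ⁻¹ u * χ (cyclotomicGenerator p : ZMod (p ^ (n + cyclotomicExponent p))) ^ (gammaLog p n u).val = 1 := by
  rw [← apply_eq_apply_cyclotomicGenerator_pow_gammaLog χ heven hord hu, ← MulChar.mul_apply, inv_mul_cancel, MulChar.one_apply hu]

end Dictionary

end Summit.BirchSwinnertonDyer.BirchSwinnertonDyer.Theorems.SmallImageRttReciprocity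

end
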